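import Summits.NavierStokesRegularity.NavierStokesRegularity.Statement
import Literature.Analysis.FluidPDE.ClassicalSolutionRescale
import Literature.Analysis.FluidPDE.TaoQuantitativeReduction
import Literature.Analysis.FluidPDE.LerayHopfNSRescale
import Literature.Analysis.FluidPDE.TaoLocalisation
import Literature.Analysis.FluidPDE.NSLerayHopf
import Literature.Analysis.FluidPDE.PressurePoisson

/-!
# Size does not matter in Clay (A): the summit for data of small energy, or of small `C^k` norm

Solo seat `solo-NavierStokesRegularity-informed` (new mathematics *about the summit statement*:
normal forms, not substitute theorems). Leray's similarity `u ↦ c u(c²t, cx)`,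
`p ↦ c² p(c²t, cx)` (`0 < c`) maps global smooth bounded-energy solutions of the unforced
system at viscosity `ν` to global smooth bounded-energy solutions at the **same** viscosity, with
datum `u₀ ↦ c u₀(c ·)`; the Schwartz class of divergence-free data is invariant. Under this map
the energy of the datum is multiplied by `c⁻¹` (on `ℝ³`) and the sup norm of its `n`-th
derivative by at most `c^{n+1}`. Hence every *supercritical* or *subcritical* smallness
condition on the datum can be enforced for free, and the summit
`NavierStokesRegularity = Literature.NS.NavierStokesExistenceSmoothR3` is equivalent to each of
its restrictions to

* data of energy `∫ |u₀|² < ε` (`navierStokesRegularity_iff_smallEnergy`, dilate with `c → ∞`);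
* data with `sup_x ‖Dⁿu₀(x)‖ ≤ ε` for all `n ≤ k` (`navierStokesRegularity_iff_smallDerivatives`,
  dilate with `c → 0`),

for any fixed `ε > 0` and `k : ℕ`. (Smallness in the *critical* norm `L³(ℝ³)`, invariant under the
map, is exactly what does suffice: Kato 1984.) This is the formal content of the slogan "the
energy is supercritical" (Tao 2016, §1.1) as a statement about the Clay problem itself: a proof
of (A) must handle data of arbitrarily small energy, and data arbitrarily small in every `C^k`.

Main results:
* `exists_globalSolution_of_nsRescaleData`: a global smooth bounded-energy solution for the
  dilated datum `c u₀(c ·)` yields one for `u₀` (same viscosity);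
* (private helpers) `hasRapidSpatialDecay_dilatedDatum`, `isDivFree_dilatedDatum`: invariance of
  the data class under dilation;
* `navierStokesRegularity_of_smallEnergy`, `navierStokesRegularity_iff_smallEnergy`;
* `navierStokesRegularity_of_smallDerivatives`, `navierStokesRegularity_iff_smallDerivatives`.

References: J. Leray, Acta Math. 63 (1934), §20 [cite: Leray1934, §20]; T. Kato, Math. Z. 187
(1984), §1 [cite: Kato1984, §1]; T. Tao, *Finite time blowup for an averaged three-dimensional
Navier–Stokes equation*, J. Amer. Math. Soc. 29 (2016) = arXiv:1402.0290, §1.1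
[cite: Tao2016AveragedNS, §1.1]; C. L. Fefferman, Clay problem description, statement (A)
[cite: Fefferman2000, (A)].
-/

open scoped ContDiff ENNReal
open MeasureTheory Set Function
open Literature.Analysis.FluidPDE

namespace Summit.NavierStokesRegularity.NavierStokesRegularity.Theorems

noncomputable section

/-! ### The data class is dilation invariant -/

section Data

variable {E : Type*} [NormedAddCommGroup E] [InnerProductSpace ℝ E]
variable {F : Type*} [NormedAddCommGroup F] [NormedSpace ℝ F]

/-- Smoothness of the dilated datum `c u₀(c ·)`. [folklore] -/
private theorem contDiff_dilatedDatum {u₀ : E → F} {n : WithTop ℕ∞} (hu₀ : ContDiff ℝ n u₀) (c : ℝ) :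
    ContDiff ℝ n (nsRescaleData c u₀) := by
  have h1 : nsRescaleData c u₀ = fun x => c • u₀ (c • x) := rfl
  rw [h1]
  exact (hu₀.comp (contDiff_const_smul c)).const_smul c

/-- **The Schwartz class is dilation invariant**: if `u₀` is smooth and rapidly decreasing with all
derivatives (Fefferman's (4)), so is `c u₀(c ·)` for `0 < c`:
`(1+|y|)^K |Dⁿ(c u₀(c ·))(y)| ≤ max(1, c⁻¹)^K c^{n+1} (1+|cy|)^K |Dⁿu₀(cy)|`
(`norm_iteratedFDeriv_nsRescaleData_le`). [folklore] -/
private theorem hasRapidSpatialDecay_dilatedDatum {u₀ : E → F} (hu₀ : ContDiff ℝ ∞ u₀)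
    (hdec : HasRapidSpatialDecay u₀) {c : ℝ} (hc : 0 < c) :
    HasRapidSpatialDecay (nsRescaleData c u₀) := by
  intro n K
  obtain ⟨C, hC⟩ := hdec n K
  set m : ℝ := max 1 c⁻¹ with hm
  have hm1 : 1 ≤ m := le_max_left _ _
  have hmc : 1 ≤ m * c := by
    have : c⁻¹ * c = 1 := inv_mul_cancel₀ hc.ne'
    nlinarith [le_max_right 1 c⁻¹, hc]
  have hn : ContDiff ℝ n u₀ := hu₀.of_le (by exact_mod_cast le_top)
  refine ⟨m ^ K * |c| ^ (n + 1) * C, fun y => ?_⟩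
  have hy : 1 + ‖y‖ ≤ m * (1 + ‖c • y‖) := by
    rw [norm_smul, Real.norm_eq_abs, abs_of_pos hc]
    nlinarith [norm_nonneg y]
  have hyK : (1 + ‖y‖) ^ K ≤ m ^ K * (1 + ‖c • y‖) ^ K := by
    rw [← mul_pow]
    exact pow_le_pow_left₀ (by positivity) hy K
  have hD := norm_iteratedFDeriv_nsRescaleData_le hn c y
  calc (1 + ‖y‖) ^ K * ‖iteratedFDeriv ℝ n (nsRescaleData c u₀) y‖
      ≤ (m ^ K * (1 + ‖c • y‖) ^ K) * (|c| ^ (n + 1) * ‖iteratedFDeriv ℝ n u₀ (c • y)‖) :=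
        mul_le_mul hyK hD (norm_nonneg _) (by positivity)
    _ = m ^ K * |c| ^ (n + 1) * ((1 + ‖c • y‖) ^ K * ‖iteratedFDeriv ℝ n u₀ (c • y)‖) := by ring
    _ ≤ m ^ K * |c| ^ (n + 1) * C :=
        mul_le_mul_of_nonneg_left (hC (c • y)) (by positivity)

/-- The sup norm of the `n`-th derivative of a rapidly decreasing field is finite (the case `K = 0`
of Fefferman's (4)), with a nonnegative bound. [folklore] -/
private theorem exists_norm_iteratedFDeriv_le_of_hasRapidSpatialDecay {u₀ : E → F}
    (hdec : HasRapidSpatialDecay u₀) (n : ℕ) :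
    ∃ C : ℝ, 0 ≤ C ∧ ∀ x, ‖iteratedFDeriv ℝ n u₀ x‖ ≤ C := by
  obtain ⟨C, hC⟩ := hdec n 0
  refine ⟨max C 0, le_max_right _ _, fun x => ?_⟩
  have h := hC x
  rw [pow_zero, one_mul] at h
  exact h.trans (le_max_left _ _)

/-- A time slice of the Leray rescaling is the dilation of the corresponding slice. [folklore] -/
private theorem nsRescale_slice_eq_dilatedSlice (c : ℝ)
    (v : ℝ → E → F) (t : ℝ) :
    Literature.Analysis.FluidPDE.nsRescale c v t = nsRescaleData c (v (c ^ 2 * t)) := by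
  funext x
  simp [nsRescale_apply, nsRescaleData_apply]

end Data

section Divergence

variable {E : Type*} [NormedAddCommGroup E] [InnerProductSpace ℝ E] [FiniteDimensional ℝ E]

/-- Chain rule for the divergence under a dilation: `div (v(c ·))(x) = c (div v)(c x)`
(junk values included: both sides vanish together when `c ≠ 0`, and for `c = 0` both are `0`).
[folklore] -/
private theorem divergence_comp_smul (v : E → E) (c : ℝ) (x : E) :
    VectorCalculus.divergence (fun y => v (c • y)) x =
      c * VectorCalculus.divergence v (c • x) := by
  have hf : stPull 0 c 0 (0 : E) (fun _ => v) 0 = fun y => v (c • y) := by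
    funext y
    simp [stPull_apply]
  have h := divergence_stPull 0 c 0 (0 : E) (fun _ => v) 0 x
  rw [hf] at h
  simpa using h

/-- The dilated datum of a smooth divergence-free field is divergence free. [folklore] -/
private theorem isDivFree_dilatedDatum {u₀ : E → E} (hu₀ : ContDiff ℝ 1 u₀) (hdiv : NSWave0.IsDivFree u₀)
    (c : ℝ) : NSWave0.IsDivFree (nsRescaleData c u₀) := by
  intro x
  have h1 : nsRescaleData c u₀ = fun y => c • (fun z => u₀ (c • z)) y := rfl
  have hd : DifferentiableAt ℝ (fun z => u₀ (c • z)) x :=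
    ((hu₀.differentiable (by simp)).comp (differentiable_id.const_smul c)).differentiableAt
  show VectorCalculus.divergence (nsRescaleData c u₀) x = 0
  rw [h1, divergence_const_smul_apply hd, divergence_comp_smul]
  have h0 : VectorCalculus.divergence u₀ (c • x) = 0 := hdiv (c • x)
  rw [h0, mul_zero, mul_zero]

end Divergence

/-! ### Undoing a dilation on a global solution -/

section Solutions

variable {E : Type*} [NormedAddCommGroup E] [InnerProductSpace ℝ E] [FiniteDimensional ℝ E]
  [MeasurableSpace E] [BorelSpace E]

/-- The half-line `[0, ∞)` is invariant under `t ↦ c² t`, `c ≠ 0`. [folklore] -/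
private theorem preimage_sq_mul_Ici {c : ℝ} (hc : c ≠ 0) :
    (fun t => c ^ 2 * t) ⁻¹' Ici (0 : ℝ) = Ici 0 := by
  ext t
  simp only [mem_preimage, mem_Ici]
  exact mul_nonneg_iff_of_pos_left (by positivity)

/-- **Undoing a dilation.** If the dilated datum `c u₀(c ·)` (`0 < c`) admits a global smooth
solution of the unforced system with viscosity `ν` and bounded energy, then so does `u₀`: rescale
the solution by `c⁻¹` (Leray 1934, §20; `IsClassicalNSSolutionOn.nsRescale_holds`), which fixes
the viscosity, maps `[0, ∞)` onto itself, returns the datum `c⁻¹ (c u₀(c c⁻¹ ·)) = u₀` and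
multiplies the energy at each time by the finite constant `c⁻² cⁿ`. [cite: Leray1934, §20] -/
theorem exists_globalSolution_of_nsRescaleData {ν : ℝ} {u₀ : E → E} {c : ℝ} (hc : 0 < c)
    (h : ∃ (u : ℝ → E → E) (p : ℝ → E → ℝ), IsSmoothOnHalfSpace u ∧ IsSmoothOnHalfSpace p ∧
      IsNavierStokesSolution ν 0 (nsRescaleData c u₀) u p ∧ HasBoundedEnergy u) :
    ∃ (u : ℝ → E → E) (p : ℝ → E → ℝ), IsSmoothOnHalfSpace u ∧ IsSmoothOnHalfSpace p ∧
      IsNavierStokesSolution ν 0 u₀ u p ∧ HasBoundedEnergy u := by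
  obtain ⟨v, q, hv, hq, hns, hE⟩ := h
  have hcl : IsClassicalNSSolutionOn (Ici 0) ν 0 v q ∧ v 0 = nsRescaleData c u₀ :=
    isNavierStokesSolution_and_smooth_iff.mp ⟨hns, hv, hq⟩
  set d : ℝ := c⁻¹ with hd
  have hd0 : 0 < d := inv_pos.mpr hc
  have hdc : d * c = 1 := inv_mul_cancel₀ hc.ne'
  -- rescale the classical solution by `d = c⁻¹`
  have key := IsClassicalNSSolutionOn.nsRescale_holds hcl.1 hd0
  rw [nsRescaleForce_zero, preimage_sq_mul_Ici hd0.ne'] at key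
  have h0 : Literature.Analysis.FluidPDE.nsRescale d v 0 = u₀ := by
    funext x
    rw [nsRescale_apply, mul_zero, hcl.2, nsRescaleData_apply, smul_smul, smul_smul, hdc,
      one_smul, mul_comm, hdc, one_smul]
  obtain ⟨hns', hu', hp'⟩ := isNavierStokesSolution_and_smooth_iff.mpr ⟨key, h0⟩
  refine ⟨Literature.Analysis.FluidPDE.nsRescale d v, nsRescalePressure d q, hu', hp', hns', ?_⟩
  -- bounded energy
  obtain ⟨C, hC, hCb⟩ := hE
  refine ⟨ENNReal.ofReal (d ^ 2) * ENNReal.ofReal (d ^ Module.finrank ℝ E)⁻¹ * C,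
    ENNReal.mul_lt_top (ENNReal.mul_lt_top ENNReal.ofReal_lt_top ENNReal.ofReal_lt_top) hC,
    fun t ht => ?_⟩
  have hslice : (fun x => Literature.Analysis.FluidPDE.nsRescale d v t x) =
      nsRescaleData d (v (d ^ 2 * t)) := nsRescale_slice_eq_dilatedSlice d v t
  simp_rw [show ∀ x, Literature.Analysis.FluidPDE.nsRescale d v t x =
      nsRescaleData d (v (d ^ 2 * t)) x from fun x => congrFun hslice x]
  rw [lintegral_enorm_sq_nsRescaleData hd0]
  exact mul_le_mul_right (hCb (d ^ 2 * t) (by positivity)) _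

end Solutions

/-! ### The summit for small data -/

/-- The energy of a smooth rapidly decreasing datum is finite. [folklore] -/
private theorem lintegral_enorm_sq_lt_top_of_hasRapidSpatialDecay
    {u₀ : EuclideanSpace ℝ (Fin 3) → EuclideanSpace ℝ (Fin 3)} (hdec : HasRapidSpatialDecay u₀) :
    ∫⁻ x, ‖u₀ x‖ₑ ^ 2 < ⊤ := by
  have h := hdec.lintegral_enorm_iteratedFDeriv_sq_lt_top (μ := volume) 0
  simp_rw [← ofReal_norm (iteratedFDeriv ℝ 0 u₀ _), norm_iteratedFDeriv_zero,
    ofReal_norm] at h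
  exact h

/-- Energy of the dilated datum on `ℝ³`: `∫ |c u₀(c x)|² dx = c⁻¹ ∫ |u₀|²`. [cite: Kato1984, §1] -/
private theorem lintegral_enorm_sq_nsRescaleData_three
    (u₀ : EuclideanSpace ℝ (Fin 3) → EuclideanSpace ℝ (Fin 3)) {c : ℝ} (hc : 0 < c) :
    ∫⁻ x, ‖nsRescaleData c u₀ x‖ₑ ^ 2 = ENNReal.ofReal c⁻¹ * ∫⁻ x, ‖u₀ x‖ₑ ^ 2 := by
  rw [lintegral_enorm_sq_nsRescaleData hc, finrank_euclideanSpace_fin,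
    ← ENNReal.ofReal_mul (sq_nonneg c)]
  congr 2
  field_simp

/-- **Clay (A) for data of small energy implies Clay (A).** If for some `ε > 0` every smooth,
divergence-free, rapidly decreasing datum on `ℝ³` *of energy `∫|u₀|² < ε`* has, for every
viscosity `ν > 0`, a global smooth bounded-energy solution of the unforced system, then the summit
`NavierStokesRegularity` holds: given any datum `u₀`, its dilation `c u₀(c ·)` has energy
`c⁻¹ ∫|u₀|² < ε` for `c` large (`lintegral_enorm_sq_nsRescaleData_three`), is again an
admissible datum (`hasRapidSpatialDecay_dilatedDatum`, `isDivFree_dilatedDatum`), and a global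
solution for it rescales back to one for `u₀` at the same viscosity
(`exists_globalSolution_of_nsRescaleData`). The energy is *supercritical*: it can be made small
without changing the problem (Tao 2016, §1.1). [cite: Tao2016AveragedNS, §1.1] [cite: Leray1934, §20] -/
theorem navierStokesRegularity_of_smallEnergy {ε : ℝ≥0∞} (hε : 0 < ε)
    (h : ∀ ν : ℝ, 0 < ν →
      ∀ u₀ : EuclideanSpace ℝ (Fin 3) → EuclideanSpace ℝ (Fin 3), ContDiff ℝ ∞ u₀ →
      NSWave0.IsDivFree u₀ → HasRapidSpatialDecay u₀ → ∫⁻ x, ‖u₀ x‖ₑ ^ 2 < ε →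
      ∃ (u : ℝ → EuclideanSpace ℝ (Fin 3) → EuclideanSpace ℝ (Fin 3))
        (p : ℝ → EuclideanSpace ℝ (Fin 3) → ℝ),
        IsSmoothOnHalfSpace u ∧ IsSmoothOnHalfSpace p ∧
          IsNavierStokesSolution ν 0 u₀ u p ∧ HasBoundedEnergy u) :
    NavierStokesRegularity := by
  intro ν hν u₀ hu₀ hdiv hdec
  -- choose the dilation factor `c = n` with `n⁻¹ ∫|u₀|² < ε`
  have hfin : ∫⁻ x, ‖u₀ x‖ₑ ^ 2 ≠ ⊤ := (lintegral_enorm_sq_lt_top_of_hasRapidSpatialDecay hdec).ne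
  obtain ⟨n, hn, hnε⟩ := ENNReal.exists_nat_pos_inv_mul_lt hfin hε.ne'
  set c : ℝ := (n : ℝ) with hcdef
  have hc : 0 < c := by rw [hcdef]; exact_mod_cast hn
  refine exists_globalSolution_of_nsRescaleData hc
    (h ν hν _ (contDiff_dilatedDatum hu₀ c)
      (isDivFree_dilatedDatum (hu₀.of_le (by exact_mod_cast le_top)) hdiv c)
      (hasRapidSpatialDecay_dilatedDatum hu₀ hdec hc) ?_)
  rw [lintegral_enorm_sq_nsRescaleData_three u₀ hc, ENNReal.ofReal_inv_of_pos hc, hcdef,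
    ENNReal.ofReal_natCast]
  exact hnε

/-- **The summit is equivalent to its restriction to data of small energy** (any fixed `ε > 0`).
[cite: Tao2016AveragedNS, §1.1] [cite: Fefferman2000, (A)] -/
theorem navierStokesRegularity_iff_smallEnergy {ε : ℝ≥0∞} (hε : 0 < ε) :
    NavierStokesRegularity ↔
      ∀ ν : ℝ, 0 < ν →
        ∀ u₀ : EuclideanSpace ℝ (Fin 3) → EuclideanSpace ℝ (Fin 3), ContDiff ℝ ∞ u₀ →
        NSWave0.IsDivFree u₀ → HasRapidSpatialDecay u₀ → ∫⁻ x, ‖u₀ x‖ₑ ^ 2 < ε →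
        ∃ (u : ℝ → EuclideanSpace ℝ (Fin 3) → EuclideanSpace ℝ (Fin 3))
          (p : ℝ → EuclideanSpace ℝ (Fin 3) → ℝ),
          IsSmoothOnHalfSpace u ∧ IsSmoothOnHalfSpace p ∧
            IsNavierStokesSolution ν 0 u₀ u p ∧ HasBoundedEnergy u :=
  ⟨fun hS ν hν u₀ hu₀ hdiv hdec _ => hS ν hν u₀ hu₀ hdiv hdec,
    fun h => navierStokesRegularity_of_smallEnergy hε h⟩

/-- **Clay (A) for `C^k`-small data implies Clay (A).** If for some `ε > 0` and `k : ℕ` every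
smooth, divergence-free, rapidly decreasing datum on `ℝ³` *with `‖Dⁿu₀(x)‖ ≤ ε` for all `n ≤ k`
and all `x`* has, for every viscosity `ν > 0`, a global smooth bounded-energy solution of the
unforced system, then the summit holds: the dilation `c u₀(c ·)` with `0 < c ≤ 1` small has
`‖Dⁿ(c u₀(c ·))‖_∞ ≤ c^{n+1} ‖Dⁿu₀‖_∞ ≤ c · max_{n ≤ k} ‖Dⁿu₀‖_∞ ≤ ε`
(`norm_iteratedFDeriv_nsRescaleData_le`), and a global solution for it rescales back
(`exists_globalSolution_of_nsRescaleData`). Pointwise smallness of finitely many derivatives is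
*subcritical* information and can be enforced for free; what grows under this dilation is the
energy (`× c⁻¹`) and the spatial extent of the datum. [cite: Leray1934, §20] [cite: Kato1984, §1] -/
theorem navierStokesRegularity_of_smallDerivatives {ε : ℝ} (hε : 0 < ε) (k : ℕ)
    (h : ∀ ν : ℝ, 0 < ν →
      ∀ u₀ : EuclideanSpace ℝ (Fin 3) → EuclideanSpace ℝ (Fin 3), ContDiff ℝ ∞ u₀ →
      NSWave0.IsDivFree u₀ → HasRapidSpatialDecay u₀ →
      (∀ n ≤ k, ∀ x, ‖iteratedFDeriv ℝ n u₀ x‖ ≤ ε) →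
      ∃ (u : ℝ → EuclideanSpace ℝ (Fin 3) → EuclideanSpace ℝ (Fin 3))
        (p : ℝ → EuclideanSpace ℝ (Fin 3) → ℝ),
        IsSmoothOnHalfSpace u ∧ IsSmoothOnHalfSpace p ∧
          IsNavierStokesSolution ν 0 u₀ u p ∧ HasBoundedEnergy u) :
    NavierStokesRegularity := by
  intro ν hν u₀ hu₀ hdiv hdec
  -- a uniform bound `M` on `‖Dⁿu₀‖_∞`, `n ≤ k`
  choose C hC0 hC using fun n => exists_norm_iteratedFDeriv_le_of_hasRapidSpatialDecay hdec n
  set M : ℝ := ∑ n ∈ Finset.range (k + 1), C n with hM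
  have hM0 : 0 ≤ M := Finset.sum_nonneg fun n _ => hC0 n
  have hCM : ∀ n ≤ k, C n ≤ M := fun n hn =>
    Finset.single_le_sum (fun i _ => hC0 i) (Finset.mem_range.mpr (Nat.lt_succ_of_le hn))
  -- the dilation factor `c = min 1 (ε / (M + 1))`
  set c : ℝ := min 1 (ε / (M + 1)) with hcdef
  have hc : 0 < c := lt_min one_pos (div_pos hε (by positivity))
  have hc1 : c ≤ 1 := min_le_left _ _
  have hcε : c * M ≤ ε := by
    calc c * M ≤ ε / (M + 1) * M := mul_le_mul_of_nonneg_right (min_le_right _ _) hM0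
      _ ≤ ε / (M + 1) * (M + 1) := mul_le_mul_of_nonneg_left (by linarith) (by positivity)
      _ = ε := div_mul_cancel₀ ε (by positivity)
  refine exists_globalSolution_of_nsRescaleData hc
    (h ν hν _ (contDiff_dilatedDatum hu₀ c)
      (isDivFree_dilatedDatum (hu₀.of_le (by exact_mod_cast le_top)) hdiv c)
      (hasRapidSpatialDecay_dilatedDatum hu₀ hdec hc) fun n hn x => ?_)
  have hn' : ContDiff ℝ n u₀ := hu₀.of_le (by exact_mod_cast le_top)
  have hcn : |c| ^ (n + 1) ≤ c := by
    rw [abs_of_pos hc]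
    exact pow_le_of_le_one hc.le hc1 (Nat.succ_ne_zero n)
  calc ‖iteratedFDeriv ℝ n (nsRescaleData c u₀) x‖
      ≤ |c| ^ (n + 1) * ‖iteratedFDeriv ℝ n u₀ (c • x)‖ := norm_iteratedFDeriv_nsRescaleData_le hn' c x
    _ ≤ c * M := mul_le_mul hcn ((hC n (c • x)).trans (hCM n hn)) (norm_nonneg _) hc.le
    _ ≤ ε := hcε

/-- **The summit is equivalent to its restriction to `C^k`-small data** (any fixed `ε > 0`,
`k : ℕ`). [cite: Leray1934, §20] [cite: Fefferman2000, (A)] -/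
theorem navierStokesRegularity_iff_smallDerivatives {ε : ℝ} (hε : 0 < ε) (k : ℕ) :
    NavierStokesRegularity ↔
      ∀ ν : ℝ, 0 < ν →
        ∀ u₀ : EuclideanSpace ℝ (Fin 3) → EuclideanSpace ℝ (Fin 3), ContDiff ℝ ∞ u₀ →
        NSWave0.IsDivFree u₀ → HasRapidSpatialDecay u₀ →
        (∀ n ≤ k, ∀ x, ‖iteratedFDeriv ℝ n u₀ x‖ ≤ ε) →
        ∃ (u : ℝ → EuclideanSpace ℝ (Fin 3) → EuclideanSpace ℝ (Fin 3))
          (p : ℝ → EuclideanSpace ℝ (Fin 3) → ℝ),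
          IsSmoothOnHalfSpace u ∧ IsSmoothOnHalfSpace p ∧
            IsNavierStokesSolution ν 0 u₀ u p ∧ HasBoundedEnergy u :=
  ⟨fun hS ν hν u₀ hu₀ hdiv hdec _ => hS ν hν u₀ hu₀ hdiv hdec,
    fun h => navierStokesRegularity_of_smallDerivatives hε k h⟩

end

end Summit.NavierStokesRegularity.NavierStokesRegularity.Theorems
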